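import Mathlib.Combinatorics.Matroid.Circuit
import Literature.Combinatorics.Matroid.RelRank
import HarnessLib

/-!
# Relative rank in a finitary matroid is attained over a finite base

A complement to `Literature/Combinatorics/Matroid/RelRank.lean` (the calculus of
`Matroid.relRank C X`, the rank of `X` in the contraction `M ／ C`): in a **finitary** matroid
(independence is of finite character — e.g. the algebraic matroid of a field extension, Mathlib's
`AlgebraicIndependent.matroid`, is finitary), the relative rank of a finite set `X` over an
arbitrary set `C` is already attained over some finite subset `C₀ ⊆ C`
(`Matroid.exists_finite_subset_relRank_eq`). For the algebraic matroid this is the familiar fact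
that the transcendence degree of finitely many elements over a (big) subfield equals their
transcendence degree over a suitable finitely generated subfield of it (all algebraic
dependencies involved have finitely many coefficients).

## References

* J. Oxley, *Matroid Theory*, 2nd ed., OUP 2011, §3.3 (rank in contractions).
-/

open Set

namespace Matroid

variable {α : Type*}

/-- **Relative rank over an arbitrary set is attained over a finite subset** (finitary matroids):
for `X` finite and `C` arbitrary (both inside the ground set) there is a finite `C₀ ⊆ C` with
`relRank C₀ X = relRank C X`. Indeed an `M ／ C`-basis `J` of `X` is finite with
`X ⊆ closure (J ∪ C)`; by finitarity (`Matroid.exists_subset_finite_closure_of_subset_closure`)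
`X ⊆ closure T` for a finite `T ⊆ J ∪ C`, and `C₀ = T ∩ C` gives
`relRank C₀ X ≤ relRank C₀ J ≤ |J| = relRank C X ≤ relRank C₀ X`. [folklore] -/
theorem exists_finite_subset_relRank_eq (M : Matroid α) [M.Finitary] {C X : Set α}
    (hX : X.Finite) (hXE : X ⊆ M.E) (hCE : C ⊆ M.E) :
    ∃ C₀ ⊆ C, C₀.Finite ∧ M.relRank C₀ X = M.relRank C X := by
  obtain ⟨J, hJ⟩ := (M ／ C).exists_isBasis' X
  have hJX : J ⊆ X := hJ.subset
  -- `X ⊆ closure (J ∪ C)`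
  have hXcl : X ⊆ M.closure (J ∪ C) := by
    intro x hx
    by_cases hxC : x ∈ C
    · exact M.mem_closure_of_mem' (Or.inr hxC) (hCE hxC)
    · have hx' : x ∈ X ∩ (M ／ C).E := ⟨hx, by rw [contract_ground]; exact ⟨hXE hx, hxC⟩⟩
      have h1 : x ∈ (M ／ C).closure X := (M ／ C).inter_ground_subset_closure X hx'
      rw [← hJ.closure_eq_closure, contract_closure_eq] at h1
      exact h1.1
  obtain ⟨T, hTJC, hTfin, -, hXT⟩ := M.exists_subset_finite_closure_of_subset_closure hX hXcl
  refine ⟨T ∩ C, inter_subset_right, hTfin.inter_of_left C, le_antisymm ?_ ?_⟩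
  · -- `relRank (T ∩ C) X ≤ relRank (T ∩ C) J ≤ |J| = relRank C X`
    have hTsub : T ⊆ J ∪ T ∩ C := by
      intro t ht
      rcases hTJC ht with htJ | htC
      · exact Or.inl htJ
      · exact Or.inr ⟨ht, htC⟩
    have h1 : M.relRank (T ∩ C) X ≤ M.relRank (T ∩ C) J :=
      M.relRank_le_of_subset_closure (T ∩ C) (hXT.trans (M.closure_subset_closure hTsub))
    refine h1.trans ?_
    calc M.relRank (T ∩ C) J ≤ (J \ (T ∩ C)).encard := M.relRank_le_encard_diff _ _
      _ ≤ J.encard := encard_le_encard sdiff_subset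
      _ = M.relRank C X := hJ.encard_eq_eRk
  · exact M.relRank_anti_left X inter_subset_right

/-- The same over the whole type as ground set (the case of the algebraic matroid of a field, whose
ground set is `univ`): for `X` finite there is a finite `C₀ ⊆ C` with
`relRank C₀ X = relRank C X`. [folklore] -/
theorem exists_finite_subset_relRank_eq_of_ground_eq_univ (M : Matroid α) [M.Finitary]
    (hE : M.E = univ) {C X : Set α} (hX : X.Finite) :
    ∃ C₀ ⊆ C, C₀.Finite ∧ M.relRank C₀ X = M.relRank C X :=
  M.exists_finite_subset_relRank_eq hX (by rw [hE]; exact subset_univ X)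
    (by rw [hE]; exact subset_univ C)

end Matroid
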